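import Summits.Schanuel.Schanuel.Theorems.ZilberEacExpExpRoot
import Summits.Schanuel.Schanuel.Theorems.ZilberEacComplexGraphEscapeLemmas
import HarnessLib

/-!
# The exp–exp balance in several variables, III: pointwise estimates

Zilber's Exponential-Algebraic Closedness, case ladder (host summit Schanuel, cell `pub-schanuel`,
seat 2, gen 10).  Estimates feeding the asymptotic existence theorem
`ZilberEacExplosionExistence` (which discharges the hypotheses of
`exists_solution_nearLine_step`):

* `perturbation_bound_of_cue` — SHARP perturbation bound: if `lc(F) u^{e} = e^{x - ζ}`,
  `‖ζ‖ ≤ R` and `Re x ≥ R + log|lc F|`, then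
  `‖(a + u F̃(u)) e^{ζ - x}‖ ≤ ‖a‖ e^{R - Re x} + (B̃/|lc F|) e^{-(Re x - R - log|lc F|)/e}`
  (no Young split: `|u| ≥ 1` is forced, so `u F̃(u)/(lc F · u^{e}) = O(1/|u|)` is exponentially
  small — needed because the `η`-scale of the slaved fibres is exponentially small);
* `polynomial_eval_aeval` — evaluation of `aeval θ G` for `θ : Fin n → ℂ[X]`;
* `two_le_natDegree_of_lineRestrict` — the restriction of `g` (`deg g = D ≥ 2`) to a line
  `z ↦ z b + a` with `g_D(b) ≠ 0` has degree `≥ 2` (analytic: `g(zb + a) = z^D g_D(b) + O(z^{D-1})`);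
* `exists_uniform_eval_bound` — one polynomial growth bound for a finite family `Aⱼ`;
* `region_re_lower`, `region_norm_le` — on the region `‖x₀ - z₀‖ ≤ 1`,
  `‖x_{j+1} - λⱼx₀ - νⱼ‖ ≤ 1` (`Re z₀ ≥ r/4`, `‖z₀‖ ≤ 5r/4`, `λⱼ ≥ λ_min > 0` real):
  `Re xⱼ ≥ λ_min(r/4 - 1) - ‖ν‖ - 1` and `‖x‖ ≤ (3 + 3‖λ‖ + ‖ν‖) r`.

HONEST FRAMING: auxiliary analysis; nothing here bears on Schanuel's conjecture; EAC ⇏ SC.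
-/

noncomputable section

open Complex MvPolynomial Filter Topology Metric
open Literature.NumberTheory.Transcendental Literature.ModelTheory.Zilber

set_option linter.dupNamespace false

namespace Summit.Schanuel.Schanuel.Theorems

section Estimates

/-- `‖u F̃(u)‖ ≤ B̃ ‖u‖^{deg F}` for `‖u‖ ≥ 1` (`F̃ = eraseLead F`, `B̃` its coefficient-norm sum;
for constant `F`, `F̃ = 0`). [folklore] -/
theorem norm_mul_eraseLead_eval_le (F : Polynomial ℂ) {u : ℂ} (hu : 1 ≤ ‖u‖) :
    ‖u * F.eraseLead.eval u‖ ≤ coeffNormSum F.eraseLead * ‖u‖ ^ F.natDegree := by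
  by_cases hf0 : F.natDegree = 0
  · have h0 : F.eraseLead = 0 := by
      rw [Polynomial.eq_C_of_natDegree_eq_zero hf0, Polynomial.eraseLead_C]
    rw [h0, Polynomial.eval_zero, mul_zero, norm_zero]
    exact mul_nonneg (coeffNormSum_nonneg _) (by positivity)
  · have h1 := norm_eval_le_of_natDegree_le F.eraseLead hu le_rfl (Polynomial.eraseLead_natDegree_le F)
    rw [norm_mul]
    calc ‖u‖ * ‖F.eraseLead.eval u‖ ≤ ‖u‖ * (coeffNormSum F.eraseLead * ‖u‖ ^ (F.natDegree - 1)) :=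
          mul_le_mul_of_nonneg_left h1 (norm_nonneg _)
      _ = coeffNormSum F.eraseLead * (‖u‖ ^ (F.natDegree - 1) * ‖u‖) := by ring
      _ = coeffNormSum F.eraseLead * ‖u‖ ^ F.natDegree := by
          rw [← pow_succ, show F.natDegree - 1 + 1 = F.natDegree by omega]

/-- **Sharp perturbation bound.**  If `lc(F) u^{e} = e^{x - ζ}` (`e = 1 + deg F`), `‖ζ‖ ≤ R` and
`Re x ≥ R + log |lc F|`, then
`‖(a + u F̃(u)) e^{ζ - x}‖ ≤ ‖a‖ e^{R - Re x} + (B̃/|lc F|) e^{-(Re x - R - log|lc F|)/e}`: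
`|u| ≥ M := e^{(Re x - R - log|lc F|)/e} ≥ 1` and `u F̃(u) e^{ζ - x} = F̃(u)/(lc F · u^{e-1}) = O(1/|u|)`.
[folklore] -/
theorem perturbation_bound_of_cue (F : Polynomial ℂ) (hF : F ≠ 0) {a u x ζ : ℂ} {R : ℝ}
    (hζ : ‖ζ‖ ≤ R) (hx : R + Real.log ‖F.leadingCoeff‖ ≤ x.re)
    (hcue : F.leadingCoeff * u ^ (F.natDegree + 1) = exp (x - ζ)) :
    ‖(a + u * F.eraseLead.eval u) * exp (ζ - x)‖ ≤
      ‖a‖ * Real.exp (R - x.re) + coeffNormSum F.eraseLead / ‖F.leadingCoeff‖ *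
        Real.exp (-((x.re - R - Real.log ‖F.leadingCoeff‖) / (F.natDegree + 1))) := by
  set c : ℂ := F.leadingCoeff with hc
  set Bt : ℝ := coeffNormSum F.eraseLead with hBt
  have hBt0 : 0 ≤ Bt := coeffNormSum_nonneg _
  have hc0 : c ≠ 0 := Polynomial.leadingCoeff_ne_zero.2 hF
  have hcpos : 0 < ‖c‖ := norm_pos_iff.2 hc0
  have hepos : (0 : ℝ) < (F.natDegree + 1 : ℝ) := by positivity
  have hζre : ζ.re ≤ R := (Complex.re_le_norm ζ).trans hζ
  have hexp : ‖exp (ζ - x)‖ ≤ Real.exp (R - x.re) := by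
    rw [Complex.norm_exp, Complex.sub_re]
    exact Real.exp_le_exp.2 (by linarith)
  have hue : ‖c‖ * ‖u‖ ^ (F.natDegree + 1) = Real.exp (x.re - ζ.re) := by
    have h := congrArg (fun w => ‖w‖) hcue
    simpa only [norm_mul, norm_pow, Complex.norm_exp, Complex.sub_re] using h
  set M : ℝ := Real.exp ((x.re - R - Real.log ‖c‖) / (F.natDegree + 1)) with hM
  have hMpos : 0 < M := Real.exp_pos _
  have hM1 : 1 ≤ M := Real.one_le_exp (div_nonneg (by linarith) hepos.le)
  have hMe : M ^ (F.natDegree + 1) = Real.exp (x.re - R) / ‖c‖ := by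
    rw [hM, ← Real.exp_nat_mul]
    push_cast
    rw [mul_div_cancel₀ _ hepos.ne', sub_eq_add_neg (x.re - R), Real.exp_add, Real.exp_neg,
      Real.exp_log hcpos, div_eq_mul_inv]
  have huM : M ≤ ‖u‖ := by
    have h1 : M ^ (F.natDegree + 1) ≤ ‖u‖ ^ (F.natDegree + 1) := by
      rw [hMe, div_le_iff₀ hcpos]
      calc Real.exp (x.re - R) ≤ Real.exp (x.re - ζ.re) := Real.exp_le_exp.2 (by linarith)
        _ = ‖u‖ ^ (F.natDegree + 1) * ‖c‖ := by rw [← hue, mul_comm]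
    exact le_of_pow_le_pow_left₀ (by omega) (norm_nonneg u) h1
  have hu1 : 1 ≤ ‖u‖ := hM1.trans huM
  have hu0 : 0 < ‖u‖ := by linarith
  -- the `F̃`-part
  have hFt : ‖u * F.eraseLead.eval u‖ ≤ Bt * ‖u‖ ^ F.natDegree := norm_mul_eraseLead_eval_le F hu1
  have hinv : ‖exp (ζ - x)‖ = (‖c‖ * ‖u‖ ^ (F.natDegree + 1))⁻¹ := by
    rw [hue, ← Real.exp_neg, Complex.norm_exp, Complex.sub_re, neg_sub]
  have hFpart : ‖u * F.eraseLead.eval u‖ * ‖exp (ζ - x)‖ ≤ Bt / ‖c‖ *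
      Real.exp (-((x.re - R - Real.log ‖c‖) / (F.natDegree + 1))) := by
    rw [hinv]
    have h1 : ‖u * F.eraseLead.eval u‖ * (‖c‖ * ‖u‖ ^ (F.natDegree + 1))⁻¹ ≤ Bt / (‖c‖ * ‖u‖) := by
      rw [← div_eq_mul_inv, div_le_div_iff₀ (by positivity) (by positivity)]
      calc ‖u * F.eraseLead.eval u‖ * (‖c‖ * ‖u‖)
          ≤ Bt * ‖u‖ ^ F.natDegree * (‖c‖ * ‖u‖) := mul_le_mul_of_nonneg_right hFt (by positivity)
        _ = Bt * (‖c‖ * ‖u‖ ^ (F.natDegree + 1)) := by rw [pow_succ]; ring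
    have h2 : Bt / (‖c‖ * ‖u‖) ≤ Bt / (‖c‖ * M) :=
      div_le_div_of_nonneg_left hBt0 (by positivity) (mul_le_mul_of_nonneg_left huM hcpos.le)
    have h3 : Bt / (‖c‖ * M) = Bt / ‖c‖ * Real.exp (-((x.re - R - Real.log ‖c‖) / (F.natDegree + 1))) := by
      rw [Real.exp_neg, ← hM]
      field_simp
    linarith [h3.le, h3.ge]
  -- assemble
  calc ‖(a + u * F.eraseLead.eval u) * exp (ζ - x)‖
      ≤ (‖a‖ + ‖u * F.eraseLead.eval u‖) * ‖exp (ζ - x)‖ := by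
        rw [norm_mul]; exact mul_le_mul_of_nonneg_right (norm_add_le _ _) (norm_nonneg _)
    _ = ‖a‖ * ‖exp (ζ - x)‖ + ‖u * F.eraseLead.eval u‖ * ‖exp (ζ - x)‖ := by ring
    _ ≤ ‖a‖ * Real.exp (R - x.re) +
          Bt / ‖c‖ * Real.exp (-((x.re - R - Real.log ‖c‖) / (F.natDegree + 1))) :=
        add_le_add (mul_le_mul_of_nonneg_left hexp (norm_nonneg _)) hFpart

/-- Evaluation of an `MvPolynomial` substituted with univariate polynomials. [folklore] -/
theorem polynomial_eval_aeval {n : ℕ} (θ : Fin n → Polynomial ℂ) (G : MvPolynomial (Fin n) ℂ)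
    (z : ℂ) : (aeval θ G).eval z = eval (fun i => (θ i).eval z) G := by
  induction G using MvPolynomial.induction_on with
  | C a => simp
  | add p q hp hq => simp [hp, hq]
  | mul_X p i hp => simp [hp]

/-- **The restriction of `g` to a line in a non-degenerate direction has degree `≥ 2`.**
If `deg g = D ≥ 2`, `g_D(b) ≠ 0` and `p(z) = g(z b + a)` for all `z`, then `deg p ≥ 2`
(from `‖g(zb + a) - z^D g_D(b)‖ = O(|z|^{D-1})`: a polynomial of degree `≤ 1` cannot follow
`z^D g_D(b)`). [folklore] -/
theorem two_le_natDegree_of_lineRestrict {n : ℕ} (g : MvPolynomial (Fin n) ℂ)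
    (hD : 2 ≤ g.totalDegree) (b a : Fin n → ℂ)
    (hα : eval b (homogeneousComponent g.totalDegree g) ≠ 0) (p : Polynomial ℂ)
    (hp : ∀ z : ℂ, p.eval z = eval (z • b + a) g) : 2 ≤ p.natDegree := by
  by_contra hlt
  have h1 : p.natDegree ≤ 1 := by omega
  obtain ⟨C, hC0, N, hC⟩ := exists_norm_eval_ray_sub_le g b
  set D := g.totalDegree with hDdef
  set α : ℂ := eval b (homogeneousComponent D g) with hαdef
  have hαpos : 0 < ‖α‖ := norm_pos_iff.2 hα
  set Bp : ℝ := coeffNormSum p with hBp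
  have hBp0 : 0 ≤ Bp := coeffNormSum_nonneg _
  set C' : ℝ := C * (1 + ‖a‖) ^ N with hC'
  have hC'0 : 0 ≤ C' := by positivity
  set R : ℝ := (Bp + C') / ‖α‖ + 1 with hR
  have hR1 : 1 ≤ R := by
    have : 0 ≤ (Bp + C') / ‖α‖ := by positivity
    linarith
  have hR0 : 0 < R := by linarith
  have hRnorm : ‖(R : ℂ)‖ = R := by rw [Complex.norm_real, Real.norm_eq_abs, abs_of_pos hR0]
  have key := hC (R : ℂ) (by rw [hRnorm]; exact hR1) a
  rw [← hp] at key
  have hpR : ‖p.eval (R : ℂ)‖ ≤ Bp * R ^ 1 :=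
    norm_eval_le_of_natDegree_le p hR1 (by rw [hRnorm]) h1
  rw [pow_one] at hpR
  have hmain : ‖(R : ℂ) ^ D * α‖ ≤ ‖p.eval (R : ℂ)‖ + C' * R ^ (D - 1) := by
    have h := norm_sub_norm_le ((R : ℂ) ^ D * α) (p.eval (R : ℂ))
    rw [norm_sub_rev] at h
    have h2 : C * (1 + ‖a‖) ^ N * ‖(R : ℂ)‖ ^ (D - 1) = C' * R ^ (D - 1) := by rw [hRnorm]
    linarith [key]
  rw [norm_mul, norm_pow, hRnorm] at hmain
  have hRD : R ^ D = R * R ^ (D - 1) := by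
    rw [← pow_succ']; congr 1; omega
  have hRle : R ≤ R ^ (D - 1) := le_self_pow₀ hR1 (by omega)
  have hpos : 0 < R ^ (D - 1) := by positivity
  -- `‖α‖ R R^{D-1} ≤ (Bp + C') R^{D-1}`
  have h3 : ‖α‖ * R * R ^ (D - 1) ≤ (Bp + C') * R ^ (D - 1) := by
    have h4 : Bp * R ≤ Bp * R ^ (D - 1) := mul_le_mul_of_nonneg_left hRle hBp0
    nlinarith
  have h5 : ‖α‖ * R ≤ Bp + C' := le_of_mul_le_mul_right h3 hpos
  have h6 : ‖α‖ * R = Bp + C' + ‖α‖ := by rw [hR]; field_simp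
  linarith

/-- One polynomial growth bound for a finite family of polynomials. [folklore] -/
theorem exists_uniform_eval_bound {s : ℕ} (A : Fin (s + 1) → MvPolynomial (Fin (s + 1)) ℂ) :
    ∃ B : ℝ, 0 ≤ B ∧ ∃ N : ℕ, ∀ j, ∀ y : Fin (s + 1) → ℂ, ‖eval y (A j)‖ ≤ B * (1 + ‖y‖) ^ N := by
  classical
  choose B hB0 N hN using fun j => HypersurfaceCover.exists_norm_eval_le_pow (r := s + 1) (A j)
  refine ⟨∑ j, B j, Finset.sum_nonneg fun j _ => hB0 j, ∑ j, N j, fun j y => ?_⟩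
  have hy : 1 ≤ 1 + ‖y‖ := le_add_of_nonneg_right (norm_nonneg _)
  calc ‖eval y (A j)‖ ≤ B j * (1 + ‖y‖) ^ N j := hN j y
    _ ≤ (∑ j, B j) * (1 + ‖y‖) ^ (∑ j, N j) :=
        mul_le_mul (Finset.single_le_sum (fun j _ => hB0 j) (Finset.mem_univ j))
          (pow_le_pow_right₀ hy (Finset.single_le_sum (fun j _ => Nat.zero_le (N j))
            (Finset.mem_univ j)))
          (by positivity) (Finset.sum_nonneg fun j _ => hB0 j)

/-- **Real parts on the region.**  If `Re z₀ ≥ r/4` with `r ≥ 4`, the slopes `λⱼ` are real with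
`λⱼ ≥ λ_min`, `0 < λ_min ≤ 1`, and `‖x₀ - z₀‖ ≤ 1`, `‖x_{j+1} - λⱼ x₀ - νⱼ‖ ≤ 1`, then
`Re xⱼ ≥ λ_min (r/4 - 1) - ‖ν‖ - 1` for every `j`. [folklore] -/
theorem region_re_lower {s : ℕ} {z₀ : ℂ} {r : ℝ} (hr : 4 ≤ r) (hre : r / 4 ≤ z₀.re)
    {lam : Fin s → ℂ} {lmin : ℝ} (hlmin : 0 < lmin) (hlmin1 : lmin ≤ 1)
    (hlam_im : ∀ j, (lam j).im = 0) (hlam_re : ∀ j, lmin ≤ (lam j).re) (ν : Fin s → ℂ)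
    {x : Fin (s + 1) → ℂ} (hx0 : ‖x 0 - z₀‖ ≤ 1)
    (hxs : ∀ j : Fin s, ‖x j.succ - lam j * x 0 - ν j‖ ≤ 1) :
    ∀ j, lmin * (r / 4 - 1) - ‖ν‖ - 1 ≤ (x j).re := by
  have hx0re : r / 4 - 1 ≤ (x 0).re := by
    have h := Complex.abs_re_le_norm (x 0 - z₀)
    rw [Complex.sub_re] at h
    have h2 := (abs_le.1 (h.trans hx0)).1
    linarith
  have hpos : 0 ≤ r / 4 - 1 := by linarith
  have hν0 : 0 ≤ ‖ν‖ := norm_nonneg _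
  intro j
  refine Fin.cases ?_ (fun i => ?_) j
  · nlinarith
  · have h := Complex.abs_re_le_norm (x i.succ - lam i * x 0 - ν i)
    rw [Complex.sub_re, Complex.sub_re, Complex.mul_re, hlam_im i, zero_mul, sub_zero] at h
    have h2 := (abs_le.1 (h.trans (hxs i))).1
    have hνi : -‖ν‖ ≤ (ν i).re :=
      (abs_le.1 ((Complex.abs_re_le_norm _).trans (norm_le_pi_norm ν i))).1
    have h3 : lmin * (r / 4 - 1) ≤ (lam i).re * (x 0).re := by
      calc lmin * (r / 4 - 1) ≤ (lam i).re * (r / 4 - 1) :=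
            mul_le_mul_of_nonneg_right (hlam_re i) hpos
        _ ≤ (lam i).re * (x 0).re :=
            mul_le_mul_of_nonneg_left hx0re (hlmin.le.trans (hlam_re i))
    linarith

/-- **Norms on the region**: `‖x‖ ≤ (3 + 3‖λ‖ + ‖ν‖) r` when `‖z₀‖ ≤ 5r/4`, `r ≥ 4`,
`‖x₀ - z₀‖ ≤ 1`, `‖x_{j+1} - λⱼ x₀ - νⱼ‖ ≤ 1`. [folklore] -/
theorem region_norm_le {s : ℕ} {z₀ : ℂ} {r : ℝ} (hr : 4 ≤ r) (hz : ‖z₀‖ ≤ 5 / 4 * r)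
    (lam ν : Fin s → ℂ) {x : Fin (s + 1) → ℂ} (hx0 : ‖x 0 - z₀‖ ≤ 1)
    (hxs : ∀ j : Fin s, ‖x j.succ - lam j * x 0 - ν j‖ ≤ 1) :
    ‖x‖ ≤ (3 + 3 * ‖lam‖ + ‖ν‖) * r := by
  have hlam0 : 0 ≤ ‖lam‖ := norm_nonneg _
  have hν0 : 0 ≤ ‖ν‖ := norm_nonneg _
  have hx0n : ‖x 0‖ ≤ 3 / 2 * r := by
    have : ‖x 0‖ ≤ ‖z₀‖ + ‖x 0 - z₀‖ := by
      calc ‖x 0‖ = ‖z₀ + (x 0 - z₀)‖ := by rw [add_sub_cancel]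
        _ ≤ ‖z₀‖ + ‖x 0 - z₀‖ := norm_add_le _ _
    linarith
  refine (pi_norm_le_iff_of_nonneg (by positivity)).2 fun j => ?_
  refine Fin.cases ?_ (fun i => ?_) j
  · nlinarith
  · have h1 : ‖x i.succ‖ ≤ ‖lam i * x 0 + ν i‖ + ‖x i.succ - lam i * x 0 - ν i‖ := by
      calc ‖x i.succ‖ = ‖(lam i * x 0 + ν i) + (x i.succ - lam i * x 0 - ν i)‖ := by ring_nf
        _ ≤ ‖lam i * x 0 + ν i‖ + ‖x i.succ - lam i * x 0 - ν i‖ := norm_add_le _ _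
    have h2 : ‖lam i * x 0 + ν i‖ ≤ ‖lam‖ * ‖x 0‖ + ‖ν‖ := by
      calc ‖lam i * x 0 + ν i‖ ≤ ‖lam i‖ * ‖x 0‖ + ‖ν i‖ := by
            refine (norm_add_le _ _).trans ?_; rw [norm_mul]
        _ ≤ ‖lam‖ * ‖x 0‖ + ‖ν‖ := by
            gcongr
            · exact norm_le_pi_norm lam i
            · exact norm_le_pi_norm ν i
    have h3 := hxs i
    nlinarith [norm_nonneg (x 0)]

end Estimates

end Summit.Schanuel.Schanuel.Theorems

end
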